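import Summits.Ventures.Crystal3D.Theorems.StickyWulffConstantNoReconstructionGainBarlowSegment
import Summits.Ventures.Crystal3D.Theorems.StickyWulffConstantNoReconstructionGainBarlowGrainFrame
import Summits.Ventures.Crystal3D.Theorems.StickyWulffConstantNoReconstructionGainOffLattice
import Summits.Ventures.Crystal3D.Theorems.StickyWulffConstantNoReconstructionGainFccShell
import HarnessLib

/-!
# From the pred-slot budget to the grain rung: the glue (misoriented Barlow grains, every tilt, every normal)

HONEST FRAMING. Part of the venture `Summits/Ventures/Crystal3D` (cell `crystal3d-full`), helper
`--supports` the crux `NoReconstructionGain` (stmt-Ventures-19144, route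
`route-Ventures-StickyWulffConstant`), line `adhesion` (wulff-p1 g13).  `…BarlowSegment` reduced the
adhesion atom for a film inside a moved Barlow stacking `A · barlowStacking 1 √(2/3) σ + c` to a
per-ball count of CERTIFIED-EMPTY end slots.  This file closes the gap between that site-level hypothesis
and the direction-level PRED-SLOT BUDGET of the census (memo PREDBUDGET-g13.md), so that the budget — a
statement about one moved hexagon, one moved up-triple, a unit normal `ν`, a depth `t > 0` and at most
three unit contact vectors with lattice angles — is the ONLY remaining input:

* `barlowPos_succ_sub_eq_const` — the up bonds of layer `k` are the up bonds of the constant stacking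
  with letter `σ k`: `pos_σ(k+1,i',j') − pos_σ(k,i,j) = pos_{σ k}(1, i'−i, j'−j)`;
* `fcc_contact_inner_cases` — two substrate contacts `u = p − q`, `u' = p' − q` of a ball `q` (unit,
  `p ≠ p' ∈ Λ₀`) have `⟪u, u'⟫ ∈ {1/2, 0, −1/2, −1}` (integrality of fcc squared distances);
* `barlowGrainFilm_slab_of_predSlotBudget` (**rung-reduction, registered by name on
  stmt-Ventures-19144**): for every `σ, A, c` and unit `ν` such that the PRED-SLOT BUDGET holds for
  `(A, ν)` (hypothesis `hB`, verbatim the census statement: for every depth `t > 0`, every set `K` of at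
  most three unit vectors `ν`-below by `t` with pairwise lattice angles, and either letter `ε = ±1`:
  `#K ≤` number of credited directions among the three `ν`-lower in-plane bonds `±A·h_j` and the three
  up bonds `A·pos_ε(1, −o)`, `o ∈ threeOffsets(−ε)`, where a direction `b` is credited if some `u ∈ K`
  has `⟪u, b⟫ > 1/2` or `⟪b, ν⟫ ≤ −t`), every finite unit packing `X ⊇ P` (fcc slab sample) whose film
  lies above the cut, off `Λ₀`, inside `A · 𝓑_σ + c` satisfies `#cross(P, X∖P) ≤ D(X∖P) + C ρ`
  (`R = 1`, `C = 0`).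

Status of `hB` (census, not proof): with the axis sign `⟪A e₃, ν⟫ ≤ 0` (up bonds point `ν`-down: the
"reading DOWN" of the memo) it holds on all samples up to basal tilt `70.5°` and, in dichotomy with the
reversed reading, on all physical samples at every tilt; in the basal cone it is the landed cap budget read
backwards.  WHAT THIS IS NOT: a proof of `hB`; rung F-C1 not moved.
-/

noncomputable section

namespace Summit.Ventures.Crystal3D.Theorems

open Summit.Ventures.Crystal3D Finset Real
open Literature.MathematicalPhysics.StatisticalMechanics (barlowPos barlowStacking fccStacking constHagg
  haggLabel IsHaggSeq threeOffsets contactDeficiency barlowPos_apply_zero barlowPos_apply_one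
  barlowPos_apply_two haggLabel_zero haggLabel_succ haggLabel_const mem_barlowStacking_iff
  le_dist_of_mem_barlowStacking_ideal isHaggSeq_const)
open scoped InnerProductSpace

/-! ### Bond vectors -/

/-- The label of layer `1` of a constant stacking is its letter. -/
theorem haggLabel_const_one (ε : ℤ) : haggLabel (fun _ : ℤ => ε) 1 = ε := by
  have := haggLabel_succ (fun _ : ℤ => ε) 0
  rw [zero_add, haggLabel_zero] at this
  simpa using this

/-- **Up bonds by the letter.**  `pos_σ(k+1,i',j') − pos_σ(k,i,j) = pos_{σ k}(1, i'−i, j'−j)` (the up bond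
of the constant stacking with letter `σ k`). -/
theorem barlowPos_succ_sub_eq_const (σ : ℤ → ℤ) (k i j i' j' : ℤ) :
    barlowPos 1 (Real.sqrt (2 / 3)) σ (k + 1) i' j' - barlowPos 1 (Real.sqrt (2 / 3)) σ k i j =
      barlowPos 1 (Real.sqrt (2 / 3)) (fun _ : ℤ => σ k) 1 (i' - i) (j' - j) := by
  have hL : haggLabel σ (k + 1) = haggLabel σ k + σ k := haggLabel_succ σ k
  have h1 := haggLabel_const_one (σ k)
  ext l
  fin_cases l <;> simp [barlowPos_apply_zero, barlowPos_apply_one, barlowPos_apply_two, hL, h1] <;> ring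

/-- The position reached from `q = A·pos_σ(k,i,j) + c` by a grain step: `A·pos y + c = q + A (pos y − pos z)`. -/
theorem moved_pos_eq_add (A : EuclideanSpace ℝ (Fin 3) ≃ₗᵢ[ℝ] EuclideanSpace ℝ (Fin 3))
    (c x y : EuclideanSpace ℝ (Fin 3)) : A y + c = (A x + c) + A (y - x) := by
  rw [map_sub]; abel

/-! ### Contacts of one ball with the substrate lattice -/

/-- Squared distances in `Λ₀` are natural numbers. -/
theorem fcc_dist_sq_natCast {p p' : EuclideanSpace ℝ (Fin 3)}
    (hp : p ∈ fccStacking 1 (Real.sqrt (2 / 3))) (hp' : p' ∈ fccStacking 1 (Real.sqrt (2 / 3))) :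
    ∃ n : ℕ, dist p p' ^ 2 = n := by
  obtain ⟨k, i, j, rfl⟩ := mem_barlowStacking_iff.1 hp
  obtain ⟨k', i', j', rfl⟩ := mem_barlowStacking_iff.1 hp'
  rw [dist_eq_norm, barlowPos_fcc_sub, norm_sq_barlowPos_fcc]
  set m : ℤ := (i - i') ^ 2 + (j - j') ^ 2 + (k - k') ^ 2 + (i - i') * (j - j') + (i - i') * (k - k') +
    (j - j') * (k - k') with hm
  have hm0 : (0 : ℝ) ≤ (m : ℝ) := by
    rw [hm, ← norm_sq_barlowPos_fcc]; positivity
  have hm0' : 0 ≤ m := by exact_mod_cast hm0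
  refine ⟨m.toNat, ?_⟩
  rw [show ((m.toNat : ℕ) : ℝ) = ((m.toNat : ℤ) : ℝ) by norm_cast, Int.toNat_of_nonneg hm0']

/-- **Lattice angles of substrate contacts.**  If `p ≠ p' ∈ Λ₀` both touch `q` (`dist = 1`), then
`⟪p − q, p' − q⟫ ∈ {1/2, 0, −1/2, −1}`. -/
theorem fcc_contact_inner_cases {p p' q : EuclideanSpace ℝ (Fin 3)}
    (hp : p ∈ fccStacking 1 (Real.sqrt (2 / 3))) (hp' : p' ∈ fccStacking 1 (Real.sqrt (2 / 3)))
    (hne : p ≠ p') (hd : dist q p = 1) (hd' : dist q p' = 1) :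
    ⟪p - q, p' - q⟫_ℝ = 1 / 2 ∨ ⟪p - q, p' - q⟫_ℝ = 0 ∨ ⟪p - q, p' - q⟫_ℝ = -1 / 2 ∨
      ⟪p - q, p' - q⟫_ℝ = -1 := by
  obtain ⟨n, hn⟩ := fcc_dist_sq_natCast hp hp'
  have hu : ‖p - q‖ = 1 := by rw [← dist_eq_norm, dist_comm, hd]
  have hu' : ‖p' - q‖ = 1 := by rw [← dist_eq_norm, dist_comm, hd']
  have hpp : dist p p' ^ 2 = 2 - 2 * ⟪p - q, p' - q⟫_ℝ := by
    have : p - p' = (p - q) - (p' - q) := by abel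
    rw [dist_eq_norm, this, norm_sub_sq_real, hu, hu']; ring
  have hge : (1 : ℝ) ≤ dist p p' ^ 2 := by
    have h1 : (1 : ℝ) ≤ dist p p' :=
      le_dist_of_mem_barlowStacking_ideal isHaggSeq_const one_pos fcc_height_sq hp hp' hne
    nlinarith
  have hle : dist p p' ^ 2 ≤ 4 := by
    have h1 : dist p p' ≤ 2 := by
      have := dist_triangle p q p'
      rw [dist_comm p q, hd, hd'] at this; linarith
    nlinarith [dist_nonneg (x := p) (y := p')]
  rw [hn] at hge hle
  have hn1 : 1 ≤ n := by exact_mod_cast hge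
  have hn4 : n ≤ 4 := by exact_mod_cast hle
  interval_cases n <;> [left; (right; left); (right; right; left); (right; right; right)] <;>
    (rw [hn] at hpp; push_cast at hpp; linarith)

/-! ### The glue -/

/-- **RUNG-REDUCTION (registered by name on stmt-Ventures-19144): the grain rung from the pred-slot
budget.**  See the module docstring for the reading of `hB`. -/
theorem barlowGrainFilm_slab_of_predSlotBudget :
    ∃ R C : ℝ, 1 ≤ R ∧ ∀ σ : ℤ → ℤ, IsHaggSeq σ →
      ∀ (A : EuclideanSpace ℝ (Fin 3) ≃ₗᵢ[ℝ] EuclideanSpace ℝ (Fin 3)) (c : EuclideanSpace ℝ (Fin 3)),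
      ∀ ν : EuclideanSpace ℝ (Fin 3), ‖ν‖ = 1 →
      (∀ t : ℝ, 0 < t → ∀ K : Finset (EuclideanSpace ℝ (Fin 3)), K.card ≤ 3 →
        (∀ u ∈ K, ‖u‖ = 1 ∧ ⟪u, ν⟫_ℝ ≤ -t) →
        (∀ u ∈ K, ∀ u' ∈ K, u ≠ u' →
          ⟪u, u'⟫_ℝ = 1 / 2 ∨ ⟪u, u'⟫_ℝ = 0 ∨ ⟪u, u'⟫_ℝ = -1 / 2) →
        ∀ ε : ℤ, (ε = 1 ∨ ε = -1) →
        (K.card : ℝ) ≤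
          (if (∃ u ∈ K, 1 / 2 < ⟪u, if ⟪A (barlowPos 1 (Real.sqrt (2 / 3)) constHagg 0 1 0), ν⟫_ℝ < 0
                then A (barlowPos 1 (Real.sqrt (2 / 3)) constHagg 0 1 0)
                else -A (barlowPos 1 (Real.sqrt (2 / 3)) constHagg 0 1 0)⟫_ℝ) ∨
              ⟪(if ⟪A (barlowPos 1 (Real.sqrt (2 / 3)) constHagg 0 1 0), ν⟫_ℝ < 0
                then A (barlowPos 1 (Real.sqrt (2 / 3)) constHagg 0 1 0)
                else -A (barlowPos 1 (Real.sqrt (2 / 3)) constHagg 0 1 0)), ν⟫_ℝ ≤ -t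
            then (1 : ℝ) else 0) +
          (if (∃ u ∈ K, 1 / 2 < ⟪u, if ⟪A (barlowPos 1 (Real.sqrt (2 / 3)) constHagg 0 0 1), ν⟫_ℝ < 0
                then A (barlowPos 1 (Real.sqrt (2 / 3)) constHagg 0 0 1)
                else -A (barlowPos 1 (Real.sqrt (2 / 3)) constHagg 0 0 1)⟫_ℝ) ∨
              ⟪(if ⟪A (barlowPos 1 (Real.sqrt (2 / 3)) constHagg 0 0 1), ν⟫_ℝ < 0
                then A (barlowPos 1 (Real.sqrt (2 / 3)) constHagg 0 0 1)
                else -A (barlowPos 1 (Real.sqrt (2 / 3)) constHagg 0 0 1)), ν⟫_ℝ ≤ -t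
            then (1 : ℝ) else 0) +
          (if (∃ u ∈ K, 1 / 2 < ⟪u, if ⟪A (barlowPos 1 (Real.sqrt (2 / 3)) constHagg 0 1 (-1)), ν⟫_ℝ < 0
                then A (barlowPos 1 (Real.sqrt (2 / 3)) constHagg 0 1 (-1))
                else -A (barlowPos 1 (Real.sqrt (2 / 3)) constHagg 0 1 (-1))⟫_ℝ) ∨
              ⟪(if ⟪A (barlowPos 1 (Real.sqrt (2 / 3)) constHagg 0 1 (-1)), ν⟫_ℝ < 0
                then A (barlowPos 1 (Real.sqrt (2 / 3)) constHagg 0 1 (-1))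
                else -A (barlowPos 1 (Real.sqrt (2 / 3)) constHagg 0 1 (-1))), ν⟫_ℝ ≤ -t
            then (1 : ℝ) else 0) +
          (((threeOffsets (-ε)).filter fun o =>
            (∃ u ∈ K, 1 / 2 < ⟪u, A (barlowPos 1 (Real.sqrt (2 / 3)) (fun _ : ℤ => ε) 1 (-o.1) (-o.2))⟫_ℝ) ∨
              ⟪A (barlowPos 1 (Real.sqrt (2 / 3)) (fun _ : ℤ => ε) 1 (-o.1) (-o.2)), ν⟫_ℝ ≤ -t).card : ℝ)) →
      ∀ ρ : ℝ, R ≤ ρ →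
      ∀ X P : Finset (EuclideanSpace ℝ (Fin 3)),
      (∀ p ∈ X, ∀ q ∈ X, p ≠ q → 1 ≤ dist p q) → P ⊆ X →
      (∀ p, p ∈ P ↔ (p ∈ fccStacking 1 (Real.sqrt (2 / 3)) ∧ -(2 * R) ≤ ⟪p, ν⟫_ℝ ∧
        ⟪p, ν⟫_ℝ ≤ -R ∧ ‖p‖ ^ 2 - ⟪p, ν⟫_ℝ ^ 2 ≤ ρ ^ 2)) →
      (∀ q ∈ X \ P, -R < ⟪q, ν⟫_ℝ) →
      (∀ q ∈ X \ P, q ∉ fccStacking 1 (Real.sqrt (2 / 3))) →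
      (∀ q ∈ X \ P, q ∈ (fun p => A p + c) '' barlowStacking 1 (Real.sqrt (2 / 3)) σ) →
      ((((P ×ˢ (X \ P)).filter fun pq => dist pq.1 pq.2 = 1).card : ℕ) : ℝ) ≤
        contactDeficiency (X \ P) + C * ρ := by
  classical
  refine ⟨1, 0, le_rfl, ?_⟩
  intro σ hσ A c ν hν hB ρ hρ X P hX hPX hP habove hoff hgrain
  rw [zero_mul, add_zero]
  -- notation
  set h₁ : EuclideanSpace ℝ (Fin 3) := A (barlowPos 1 (Real.sqrt (2 / 3)) constHagg 0 1 0) with hh₁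
  set h₂ : EuclideanSpace ℝ (Fin 3) := A (barlowPos 1 (Real.sqrt (2 / 3)) constHagg 0 0 1) with hh₂
  set h₃ : EuclideanSpace ℝ (Fin 3) := A (barlowPos 1 (Real.sqrt (2 / 3)) constHagg 0 1 (-1)) with hh₃
  -- global orientation of the three in-layer families
  set s₁ : Bool := decide (⟪h₁, ν⟫_ℝ < 0) with hs₁
  set s₂ : Bool := decide (⟪h₂, ν⟫_ℝ < 0) with hs₂
  set s₃ : Bool := decide (⟪h₃, ν⟫_ℝ < 0) with hs₃
  have hbelow : ∀ p ∈ P, ⟪p, ν⟫_ℝ ≤ -1 := fun p hp => ((hP p).1 hp).2.2.1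
  refine barlowGrain_cross_le_of_slotCertificates hσ A c ν 1 s₁ s₂ s₃ X P hX hPX habove hgrain ?_
  intro k i j hq
  set q := A (barlowPos 1 (Real.sqrt (2 / 3)) σ k i j) + c with hqdef
  -- the contact set, as vectors
  set N := P.filter fun p => dist q p = 1 with hN
  set K := N.image fun p => p - q with hK
  have hKcard : K.card = N.card := card_image_of_injective _ sub_left_injective
  have hNmem : ∀ p ∈ N, p ∈ P ∧ p ∈ fccStacking 1 (Real.sqrt (2 / 3)) ∧ dist q p = 1 := fun p hp =>
    ⟨(mem_filter.1 hp).1, ((hP p).1 (mem_filter.1 hp).1).1, (mem_filter.1 hp).2⟩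
  have hKmem : ∀ u ∈ K, ∃ p ∈ N, p - q = u := fun u hu => by simpa [hK] using hu
  -- depth
  set t : ℝ := ⟪q, ν⟫_ℝ + 1 with ht
  have htpos : 0 < t := by have := habove q hq; rw [ht]; linarith
  -- hypotheses of the budget
  have hN3 : N.card ≤ 3 :=
    fcc_offLattice_unitContacts_le_three q (hoff q hq) N fun y hy => ⟨(hNmem y hy).2.1, (hNmem y hy).2.2⟩
  have hK3 : K.card ≤ 3 := hKcard ▸ hN3
  have hKunit : ∀ u ∈ K, ‖u‖ = 1 ∧ ⟪u, ν⟫_ℝ ≤ -t := by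
    intro u hu
    obtain ⟨p, hp, rfl⟩ := hKmem u hu
    refine ⟨by rw [← dist_eq_norm, dist_comm, (hNmem p hp).2.2], ?_⟩
    rw [inner_sub_left, ht]
    linarith [hbelow p (hNmem p hp).1]
  have hKang : ∀ u ∈ K, ∀ u' ∈ K, u ≠ u' →
      ⟪u, u'⟫_ℝ = 1 / 2 ∨ ⟪u, u'⟫_ℝ = 0 ∨ ⟪u, u'⟫_ℝ = -1 / 2 := by
    intro u hu u' hu' hne
    obtain ⟨p, hp, rfl⟩ := hKmem u hu
    obtain ⟨p', hp', rfl⟩ := hKmem u' hu'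
    have hpp : p ≠ p' := fun h => hne (by rw [h])
    rcases fcc_contact_inner_cases (hNmem p hp).2.1 (hNmem p' hp').2.1 hpp (hNmem p hp).2.2
      (hNmem p' hp').2.2 with h | h | h | h
    · exact Or.inl h
    · exact Or.inr (Or.inl h)
    · exact Or.inr (Or.inr h)
    · -- antipodal contacts cannot both be below
      exfalso
      have h1 := (hKunit _ hu).2
      have h2 := (hKunit _ hu').2
      have hu1 := (hKunit _ hu).1
      have hu2 := (hKunit _ hu').1
      have hsum : ‖(p - q) + (p' - q)‖ ^ 2 = 0 := by
        rw [norm_add_sq_real, hu1, hu2, h]; ring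
      have h0 : (p - q) + (p' - q) = 0 := by
        rw [← norm_eq_zero]; nlinarith [norm_nonneg ((p - q) + (p' - q))]
      have : ⟪(p - q) + (p' - q), ν⟫_ℝ = 0 := by rw [h0, inner_zero_left]
      rw [inner_add_left] at this
      linarith
  have hBq := hB t htpos K hK3 hKunit hKang (σ k) (hσ k)
  -- rewrite `#K` as the number of substrate contacts
  rw [hKcard] at hBq
  refine hBq.trans ?_
  -- credited direction ⇒ certified slot, term by term
  have hcert : ∀ b : EuclideanSpace ℝ (Fin 3), ‖b‖ = 1 →
      ((∃ u ∈ K, 1 / 2 < ⟪u, b⟫_ℝ) ∨ ⟪b, ν⟫_ℝ ≤ -t) →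
      ((∃ p ∈ P, dist q p = 1 ∧ dist (q + b) p < 1) ∨ ⟪q + b, ν⟫_ℝ ≤ -1) := by
    intro b hb hcr
    rcases hcr with ⟨u, hu, hub⟩ | hbn
    · obtain ⟨p, hp, rfl⟩ := hKmem u hu
      refine Or.inl ⟨p, (hNmem p hp).1, (hNmem p hp).2.2, ?_⟩
      have hu1 := (hKunit _ hu).1
      have hsq : dist (q + b) p ^ 2 < 1 := by
        rw [dist_eq_norm, show q + b - p = b - (p - q) by abel, norm_sub_sq_real, hb, hu1,
          real_inner_comm]
        linarith
      nlinarith [dist_nonneg (x := q + b) (y := p)]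
    · right
      rw [inner_add_left]
      rw [ht] at hbn
      linarith
  -- the slots as `q + b`
  have hslot_in : ∀ a b : ℤ, A (barlowPos 1 (Real.sqrt (2 / 3)) σ k (i + a) (j + b)) + c =
      q + A (barlowPos 1 (Real.sqrt (2 / 3)) constHagg 0 a b) := by
    intro a b
    rw [hqdef, moved_pos_eq_add A c (barlowPos 1 (Real.sqrt (2 / 3)) σ k i j), barlowPos_sub_eq_fcc]
    simp
  have hslot_up : ∀ o : ℤ × ℤ, A (barlowPos 1 (Real.sqrt (2 / 3)) σ (k + 1) (i - o.1) (j - o.2)) + c =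
      q + A (barlowPos 1 (Real.sqrt (2 / 3)) (fun _ : ℤ => σ k) 1 (-o.1) (-o.2)) := by
    intro o
    rw [hqdef, moved_pos_eq_add A c (barlowPos 1 (Real.sqrt (2 / 3)) σ k i j), barlowPos_succ_sub_eq_const,
      show i - o.1 - i = -o.1 by ring, show j - o.2 - j = -o.2 by ring]
  -- unit bonds
  have hunit_in : ∀ a b : ℤ, (a, b) = (1, 0) ∨ (a, b) = (0, 1) ∨ (a, b) = (1, -1) →
      ‖A (barlowPos 1 (Real.sqrt (2 / 3)) constHagg 0 a b)‖ = 1 := by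
    intro a b hab
    rw [LinearIsometryEquiv.norm_map]
    refine norm_barlowPos_fcc_eq_one ?_
    rcases hab with h | h | h <;> simp only [Prod.mk.injEq] at h <;> obtain ⟨rfl, rfl⟩ := h <;> norm_num
  have hunit_up : ∀ o ∈ threeOffsets (-σ k),
      ‖A (barlowPos 1 (Real.sqrt (2 / 3)) (fun _ : ℤ => σ k) 1 (-o.1) (-o.2))‖ = 1 := by
    intro o ho
    have e : barlowPos 1 (Real.sqrt (2 / 3)) σ (k + 1) (i - o.1) (j - o.2) - barlowPos 1 (Real.sqrt (2 / 3)) σ k i j =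
        barlowPos 1 (Real.sqrt (2 / 3)) (fun _ : ℤ => σ k) 1 (-o.1) (-o.2) := by
      rw [barlowPos_succ_sub_eq_const, show i - o.1 - i = -o.1 by ring, show j - o.2 - j = -o.2 by ring]
    rw [LinearIsometryEquiv.norm_map, ← e, ← dist_eq_norm, dist_comm]
    exact (site_adj_iff hσ (k, i, j) (k + 1, i - o.1, j - o.2)).2 (Or.inr (Or.inl ⟨rfl, by simpa using ho⟩))
  -- one in-layer term
  have hterm : ∀ (b slot : EuclideanSpace ℝ (Fin 3)), ‖b‖ = 1 → slot = q + b →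
      (if (∃ u ∈ K, 1 / 2 < ⟪u, b⟫_ℝ) ∨ ⟪b, ν⟫_ℝ ≤ -t then (1 : ℝ) else 0) ≤
        (if (∃ p ∈ P, dist q p = 1 ∧ dist slot p < 1) ∨ ⟪slot, ν⟫_ℝ ≤ -1 then (1 : ℝ) else 0) := by
    intro b slot hb hslot
    by_cases hc : (∃ u ∈ K, 1 / 2 < ⟪u, b⟫_ℝ) ∨ ⟪b, ν⟫_ℝ ≤ -t
    · rw [if_pos hc, if_pos (by rw [hslot]; exact hcert b hb hc)]
    · rw [if_neg hc]; split_ifs <;> norm_num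
  -- the oriented in-layer slots are `q + (lower of ±h_j)`
  have hn1 : A (barlowPos 1 (Real.sqrt (2 / 3)) constHagg 0 (-1) 0) = -h₁ := by
    have e := barlowPos_fcc_neg 0 1 0
    simp only [neg_zero] at e
    rw [e, map_neg]
  have hn2 : A (barlowPos 1 (Real.sqrt (2 / 3)) constHagg 0 0 (-1)) = -h₂ := by
    have e := barlowPos_fcc_neg 0 0 1
    simp only [neg_zero] at e
    rw [e, map_neg]
  have hn3 : A (barlowPos 1 (Real.sqrt (2 / 3)) constHagg 0 (-1) 1) = -h₃ := by
    have e := barlowPos_fcc_neg 0 1 (-1)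
    simp only [neg_zero, neg_neg] at e
    rw [e, map_neg]
  have hslot1 : A (barlowPos 1 (Real.sqrt (2 / 3)) σ k (i + (if s₁ then 1 else -1)) j) + c =
      q + (if ⟪h₁, ν⟫_ℝ < 0 then h₁ else -h₁) := by
    by_cases hc : ⟪h₁, ν⟫_ℝ < 0
    · have hv : s₁ = true := by simp [hs₁, hc]
      have e := hslot_in 1 0
      rw [add_zero] at e
      rw [hv, if_pos rfl, if_pos hc]
      exact e
    · have hv : s₁ = false := by simp [hs₁, hc]
      have e := hslot_in (-1) 0
      rw [add_zero, hn1] at e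
      rw [hv, if_neg Bool.false_ne_true, if_neg hc]
      exact e
  have hslot2 : A (barlowPos 1 (Real.sqrt (2 / 3)) σ k i (j + (if s₂ then 1 else -1))) + c =
      q + (if ⟪h₂, ν⟫_ℝ < 0 then h₂ else -h₂) := by
    by_cases hc : ⟪h₂, ν⟫_ℝ < 0
    · have hv : s₂ = true := by simp [hs₂, hc]
      have e := hslot_in 0 1
      rw [add_zero] at e
      rw [hv, if_pos rfl, if_pos hc]
      exact e
    · have hv : s₂ = false := by simp [hs₂, hc]
      have e := hslot_in 0 (-1)
      rw [add_zero, hn2] at e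
      rw [hv, if_neg Bool.false_ne_true, if_neg hc]
      exact e
  have hslot3 : A (barlowPos 1 (Real.sqrt (2 / 3)) σ k (i + (if s₃ then 1 else -1))
      (j + (if s₃ then -1 else 1))) + c = q + (if ⟪h₃, ν⟫_ℝ < 0 then h₃ else -h₃) := by
    by_cases hc : ⟪h₃, ν⟫_ℝ < 0
    · have hv : s₃ = true := by simp [hs₃, hc]
      have e := hslot_in 1 (-1)
      rw [hv, if_pos rfl, if_pos rfl, if_pos hc]
      exact e
    · have hv : s₃ = false := by simp [hs₃, hc]
      have e := hslot_in (-1) 1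
      rw [hn3] at e
      rw [hv, if_neg Bool.false_ne_true, if_neg Bool.false_ne_true, if_neg hc]
      exact e
  have hb1 : ‖(if ⟪h₁, ν⟫_ℝ < 0 then h₁ else -h₁)‖ = 1 := by
    split_ifs
    · exact hunit_in 1 0 (Or.inl rfl)
    · rw [norm_neg]; exact hunit_in 1 0 (Or.inl rfl)
  have hb2 : ‖(if ⟪h₂, ν⟫_ℝ < 0 then h₂ else -h₂)‖ = 1 := by
    split_ifs
    · exact hunit_in 0 1 (Or.inr (Or.inl rfl))
    · rw [norm_neg]; exact hunit_in 0 1 (Or.inr (Or.inl rfl))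
  have hb3 : ‖(if ⟪h₃, ν⟫_ℝ < 0 then h₃ else -h₃)‖ = 1 := by
    split_ifs
    · exact hunit_in 1 (-1) (Or.inr (Or.inr rfl))
    · rw [norm_neg]; exact hunit_in 1 (-1) (Or.inr (Or.inr rfl))
  -- the chain term
  have hchain : (((threeOffsets (-σ k)).filter fun o =>
      (∃ u ∈ K, 1 / 2 < ⟪u, A (barlowPos 1 (Real.sqrt (2 / 3)) (fun _ : ℤ => σ k) 1 (-o.1) (-o.2))⟫_ℝ) ∨
        ⟪A (barlowPos 1 (Real.sqrt (2 / 3)) (fun _ : ℤ => σ k) 1 (-o.1) (-o.2)), ν⟫_ℝ ≤ -t).card : ℝ) ≤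
      (((threeOffsets (-σ k)).filter fun o =>
        (∃ p ∈ P, dist q p = 1 ∧
            dist (A (barlowPos 1 (Real.sqrt (2 / 3)) σ (k + 1) (i - o.1) (j - o.2)) + c) p < 1) ∨
          ⟪A (barlowPos 1 (Real.sqrt (2 / 3)) σ (k + 1) (i - o.1) (j - o.2)) + c, ν⟫_ℝ ≤ -(1 : ℝ)).card : ℝ) := by
    have hsub : ((threeOffsets (-σ k)).filter fun o =>
        (∃ u ∈ K, 1 / 2 < ⟪u, A (barlowPos 1 (Real.sqrt (2 / 3)) (fun _ : ℤ => σ k) 1 (-o.1) (-o.2))⟫_ℝ) ∨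
          ⟪A (barlowPos 1 (Real.sqrt (2 / 3)) (fun _ : ℤ => σ k) 1 (-o.1) (-o.2)), ν⟫_ℝ ≤ -t) ⊆
        ((threeOffsets (-σ k)).filter fun o =>
          (∃ p ∈ P, dist q p = 1 ∧
              dist (A (barlowPos 1 (Real.sqrt (2 / 3)) σ (k + 1) (i - o.1) (j - o.2)) + c) p < 1) ∨
            ⟪A (barlowPos 1 (Real.sqrt (2 / 3)) σ (k + 1) (i - o.1) (j - o.2)) + c, ν⟫_ℝ ≤ -(1 : ℝ)) := by
      intro o ho
      rw [mem_filter] at ho ⊢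
      refine ⟨ho.1, ?_⟩
      rw [hslot_up o]
      exact hcert _ (hunit_up o ho.1) ho.2
    exact_mod_cast card_le_card hsub
  have h1 := hterm _ _ hb1 hslot1
  have h2 := hterm _ _ hb2 hslot2
  have h3 := hterm _ _ hb3 hslot3
  rw [hqdef] at h1 h2 h3 hchain
  linarith

end Summit.Ventures.Crystal3D.Theorems

end
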